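import Mathlib
import HarnessLib
import Summits.HubbardSuperconductivity.HubbardSuperconductivity.Theorems.KLProgrammeKLRegimeEngineScaleZeroPartitionFnUnit
import Summits.HubbardSuperconductivity.HubbardSuperconductivity.Theorems.KLProgrammeKLRegimeEngineScaleZeroE4Geometry
import Summits.HubbardSuperconductivity.HubbardSuperconductivity.Theorems.KLProgrammeKLRegimeEngineTowerDoorToKitPrescribed

/-!
# Route `KLProgramme` — crux K3 ENGINE (stmt-HubbardSuperconductivity-20437 `KLRegimeEngineV17F2`), stub (b) v2, THE LEVELS PACKAGE (ℓ):
# «(ℓ)-Z-THREAD», the BASE — THE PARTITION FUNCTION AT THE FIRST BLOCK BOUNDARY `Λ_d` IS A UNIT UNDER THE BASE BLOCK'S OWN GRID-STEP DATA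
# (located item #18 «(Z)-EXPORT» / register #17 «(ℓ)-Z-THREAD», pen (R87)/(R306); cell gate-hubbard-kl, seat hubbard-kl-k3c3-p2 g16)

The tokenised floor-keyed law (`…TowerLevBaseFWgridTok.klTowerBLevF_le_law_lev_of_doors_of_wgridStep_tok`, p4's `klTowerBLevF_le_law_lev_of_blocks_tok/_Z`)
carries `Z^K_{Λ_{dk}} ≠ 0` along the blocks from ONE base datum `Z^K_{Λ_d} ≠ 0` (the token `Zk 1`).  That datum costs nothing: the base block of the
floor-keyed law is p3's weighted grid step at `(Λ_d, F_{d−1})`, i.e. the single determinant-bounded integration of ALL fields above `Λ_d` on the time grid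
`S = hubbardGridSub L M β (4M)` from the grid vertex `Ṽ = V_{4M} + 𝒩_{K,4M}`, under a replica Gram constant `κ` of `SᵀC^K_{>Λ_d}S`, `gridLabelWt`-weighted row /
column sums `≤ α_w`, and the smallness `e·α_w·‖Ṽ‖_{κ,ρ}/κ² < 1` for the (weighted) pinned profile of `Ṽ`.  The determinant-bounded door's FIRST conjunct
(`sum_norm_kernel_effAction_add_sum_cumulant_le_of_gramBounded … .1`) is the statement that the step partition function is a unit, and
`gridEffPartitionFn_eq_hubbardEffPartitionFnCT` identifies it with `Z^K_{Λ_d}` — exactly p5 g13's `isUnit_hubbardEffPartitionFnCT_scaleZero_of_gridStep` at a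
general cutoff.

* **`isUnit_hubbardEffPartitionFnCT_of_gridStep`** — any cutoff `Λ`: unweighted rows/columns `≤ α`, profile entry `kK ≥ Σ_z ‖Ǩ_L(z)‖`, `θ < 1` ⊢ `IsUnit Z^K_Λ`
  (p5's proof verbatim with `Λ` for `Λ_0`);
* **`hubbardEffPartitionFnCT_klScale_ne_zero_of_wgridStep`** — at `Λ := Λ_d` under the BASE BINDERS OF THE FLOOR-KEYED LAW VERBATIM (`κ, hGB`, the
  `gridLabelWt`-weighted rows/columns `≤ α_w`, `ρ`, the weighted-profile smallness `θ_w < 1` of `klTowerBLevF_le_law_lev_of_doors_of_wgridStep[_tok]`):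
  `Z^K_{Λ_d} ≠ 0` (the weight is `≥ 1`: `one_le_gridLabelWt`; the weighted profile dominates the plain one: `normV_mono`) — so the tokenised law's `hZ1` is
  discharged by hypotheses it already carries, and the partition function along the blocks is a pure OUTPUT of the law.
Compositions of landed theorems; nothing about the model is asserted beyond them; nothing asserts (ℓ), any stub, K3 or superconductivity.
References: BGM 2006 §2.1 (2.5)–(2.6), §2.3 (2.13)–(2.14), §3 (3.2)–(3.8) [cite: BenfattoGiulianiMastropietro2006].
-/

noncomputable section

namespace Summit.HubbardSuperconductivity.HubbardSuperconductivity.Theorems.EngineV8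

set_option linter.dupNamespace false -- summit = problem name (single-conjunct summit), D-0017

open Real Finset Literature.MathematicalPhysics.QuantumLattice Literature.Probability.LatticeModels GrassmannAlgebra
open Summit.HubbardSuperconductivity.HubbardSuperconductivity.Theorems.KLRegimeSplit
open Summit.HubbardSuperconductivity.HubbardSuperconductivity.Theorems.KLProgrammeLegKernels
open Summit.HubbardSuperconductivity.HubbardSuperconductivity.Theorems.ScaleZeroDecay

variable {L M : ℕ} [NeZero L]

/-! ## §1 Any cutoff: the grid-step partition function is a unit modulo `(κ, α, θ)` -/

/-- **`Z^K_Λ` is a unit, modulo `(κ, α, θ)`** (p5 g13's `isUnit_hubbardEffPartitionFnCT_scaleZero_of_gridStep` at a general cutoff `Λ`):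
`S = hubbardGridSub L M β (4M)`; if `SᵀC^K_{>Λ}S` is replica-Gram-bounded with constant `κ > 0` and has row and column sums `≤ α`, and
`θ = e·α·‖Ṽ‖_{κ,ρ}/κ² < 1` for the grid vertex's pinned profile (entry `kK ≥ Σ_z ‖Ǩ_L(z)‖`), then `hubbardEffPartitionFnCT L M β U μ 0 K Λ` is a unit.
[cite: BenfattoGiulianiMastropietro2006, §2.3 (2.13)-(2.14), §3 (3.2)-(3.8)] -/
theorem isUnit_hubbardEffPartitionFnCT_of_gridStep [NeZero M] {β : ℝ} (hβ : 0 < β) (U μ : ℝ) (K : TrigPolyC4v) (Λ : ℝ) {kK : ℝ}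
    (hkK : ∑ z : TorusSite 2 L, ‖framePosKernel L K z‖ ≤ kK) {κ : ℝ} (hκ : 0 < κ)
    (hGB : IsGramBoundedR ((hubbardGridSub L M β (2 * (2 * M))).transpose * hubbardCovAboveCT L M β μ 0 K Λ *
      hubbardGridSub L M β (2 * (2 * M))) κ)
    {α : ℝ} (hα : 0 < α)
    (hrow : ∀ X, ∑ Y, ‖((hubbardGridSub L M β (2 * (2 * M))).transpose * hubbardCovAboveCT L M β μ 0 K Λ *
      hubbardGridSub L M β (2 * (2 * M))) X Y‖ ≤ α)
    (hcol : ∀ Y, ∑ X, ‖((hubbardGridSub L M β (2 * (2 * M))).transpose * hubbardCovAboveCT L M β μ 0 K Λ *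
      hubbardGridSub L M β (2 * (2 * M))) X Y‖ ≤ α)
    {ρ : ℝ} (hρ : 0 < ρ)
    (hθ : Real.exp 1 * α * normV (GridLeg (GridPoint L (2 * (2 * M)))) κ ρ
      ((fun m' : ℕ => if m' = 1 then |β| / (2 * (2 * M) : ℕ) * kK else if m' = 2 then |U| * |β| / (2 * (2 * M) : ℕ) else 0)) / κ ^ 2 < 1) :
    IsUnit (hubbardEffPartitionFnCT L M β U μ 0 K Λ) := by
  classical
  set Ng : ℕ := 2 * (2 * M) with hNg
  set Vt := hubbardGridInteraction L Ng β U + hubbardGridCounterQuadratic L Ng β K with hVt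
  have hVt_even : Vt ∈ evenPart ℂ (GridLeg (GridPoint L Ng)) :=
    add_mem (hubbardGridInteraction_mem_evenPart β U) (hubbardGridCounterQuadratic_mem_evenPart β K)
  have hVt0 : constPart ℂ Vt = 0 := by
    rw [hVt, map_add, constPart_hubbardGridInteraction, constPart_hubbardGridCounterQuadratic, add_zero]
  have hkK0 : 0 ≤ kK := le_trans (sum_nonneg fun _ _ => norm_nonneg _) hkK
  -- the determinant-bounded door on the grid algebra, first conjunct
  have hunit := (sum_norm_kernel_effAction_add_sum_cumulant_le_of_gramBounded
    ((hubbardGridSub L M β Ng).transpose * hubbardCovAboveCT L M β μ 0 K Λ * hubbardGridSub L M β Ng) hκ hGB Vt hVt_even hVt0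
    (fun m' : ℕ => if m' = 1 then |β| / Ng * kK else if m' = 2 then |U| * |β| / Ng else 0) (scaleZeroPinnedL1_nonneg β U hkK0 Ng)
    (sum_norm_kernel_gridVertex_le_l1 β U K hkK) hα hrow hcol hρ hθ one_pos).1
  -- the grid partition function is `Z^K_Λ`
  rw [← gridEffPartitionFn_eq_hubbardEffPartitionFnCT hβ.ne' U μ K Λ]
  exact hunit

/-! ## §2 At `Λ_d`, under the base binders of the floor-keyed law verbatim -/

/-- **`Z^K_{Λ_d} ≠ 0` UNDER THE BASE BLOCK'S WEIGHTED GRID-STEP DATA** — the `jw/κ/hGB/α_w/rows/cols/ρ/θ_w` binders of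
`klTowerBLevF_le_law_lev_of_doors_of_wgridStep[_tok]` (…TowerLevBaseFWgrid[Tok]) VERBATIM: the `gridLabelWt`-weighted rows dominate the plain rows (`gridLabelWt ≥ 1`)
and the weighted pinned profile `(|β|/4M)·Σ_z ‖Ǩ_L(z)‖(1 + |z|)` dominates the plain one, so §1 applies.  This discharges the tokenised law's base token `Zk 1`.
[cite: BenfattoGiulianiMastropietro2006, §2.3 (2.13)-(2.14), §3 (3.2)-(3.8)] -/
theorem hubbardEffPartitionFnCT_klScale_ne_zero_of_wgridStep [NeZero M] {β : ℝ} (hβ : 0 < β) (U μ : ℝ) (K : TrigPolyC4v) (d : ℕ)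
    {κ : ℝ} (hκ : 0 < κ)
    (hGB : IsGramBoundedR ((hubbardGridSub L M β (2 * (2 * M))).transpose * hubbardCovAboveCT L M β μ 0 K (klScale klE0 d) *
      hubbardGridSub L M β (2 * (2 * M))) κ)
    {αw : ℝ} (hαw : 0 < αw)
    (hrow : ∀ X, ∑ Y, ‖((hubbardGridSub L M β (2 * (2 * M))).transpose * hubbardCovAboveCT L M β μ 0 K (klScale klE0 d) *
      hubbardGridSub L M β (2 * (2 * M))) X Y‖ * gridLabelWt L (2 * (2 * M)) β {gridLegPos X, gridLegPos Y} ≤ αw)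
    (hcol : ∀ Y, ∑ X, ‖((hubbardGridSub L M β (2 * (2 * M))).transpose * hubbardCovAboveCT L M β μ 0 K (klScale klE0 d) *
      hubbardGridSub L M β (2 * (2 * M))) X Y‖ * gridLabelWt L (2 * (2 * M)) β {gridLegPos X, gridLegPos Y} ≤ αw)
    {ρ : ℝ} (hρ : 0 < ρ)
    (hθ : Real.exp 1 * αw * normV (GridLeg (GridPoint L (2 * (2 * M)))) κ ρ
      (fun m' : ℕ => if m' = 1 then |β| / (2 * (2 * M) : ℕ) * ∑ z : TorusSite 2 L, ‖framePosKernel L K z‖ * (1 + torusSiteDist z 0)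
        else if m' = 2 then |U| * |β| / (2 * (2 * M) : ℕ) else 0) / κ ^ 2 < 1) :
    hubbardEffPartitionFnCT L M β U μ 0 K (klScale klE0 d) ≠ 0 := by
  -- the plain rows from the weighted rows (`gridLabelWt ≥ 1`)
  have hrow' : ∀ X, ∑ Y, ‖((hubbardGridSub L M β (2 * (2 * M))).transpose * hubbardCovAboveCT L M β μ 0 K (klScale klE0 d) *
      hubbardGridSub L M β (2 * (2 * M))) X Y‖ ≤ αw := fun X =>
    (sum_le_sum fun Y _ => le_mul_of_one_le_right (norm_nonneg _) (one_le_gridLabelWt _ _ _ _)).trans (hrow X)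
  have hcol' : ∀ Y, ∑ X, ‖((hubbardGridSub L M β (2 * (2 * M))).transpose * hubbardCovAboveCT L M β μ 0 K (klScale klE0 d) *
      hubbardGridSub L M β (2 * (2 * M))) X Y‖ ≤ αw := fun Y =>
    (sum_le_sum fun X _ => le_mul_of_one_le_right (norm_nonneg _) (one_le_gridLabelWt _ _ _ _)).trans (hcol Y)
  -- the plain profile under the weighted one
  have hprof : ∀ m' : ℕ,
      (if m' = 1 then |β| / (2 * (2 * M) : ℕ) * ∑ z : TorusSite 2 L, ‖framePosKernel L K z‖ else if m' = 2 then |U| * |β| / (2 * (2 * M) : ℕ) else 0 : ℝ) ≤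
      (if m' = 1 then |β| / (2 * (2 * M) : ℕ) * ∑ z : TorusSite 2 L, ‖framePosKernel L K z‖ * (1 + torusSiteDist z 0)
        else if m' = 2 then |U| * |β| / (2 * (2 * M) : ℕ) else 0 : ℝ) := by
    intro m'
    split_ifs
    · refine mul_le_mul_of_nonneg_left (sum_le_sum fun z _ => ?_) (by positivity)
      exact le_mul_of_one_le_right (norm_nonneg _) (le_add_of_nonneg_right (by unfold torusSiteDist; exact Nat.cast_nonneg _))
    · exact le_rfl
    · exact le_rfl
  have hθ' : Real.exp 1 * αw * normV (GridLeg (GridPoint L (2 * (2 * M)))) κ ρ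
      ((fun m' : ℕ => if m' = 1 then |β| / (2 * (2 * M) : ℕ) * ∑ z : TorusSite 2 L, ‖framePosKernel L K z‖
        else if m' = 2 then |U| * |β| / (2 * (2 * M) : ℕ) else 0)) / κ ^ 2 < 1 := by
    refine lt_of_le_of_lt ?_ hθ
    exact div_le_div_of_nonneg_right (mul_le_mul_of_nonneg_left (normV_mono hκ.le hρ.le hprof) (by positivity)) (sq_nonneg κ)
  exact (isUnit_hubbardEffPartitionFnCT_of_gridStep hβ U μ K (klScale klE0 d) le_rfl hκ hGB hαw hrow' hcol' hρ hθ').ne_zero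

end Summit.HubbardSuperconductivity.HubbardSuperconductivity.Theorems.EngineV8

end
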